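import Summits.HodgeConjecture.HodgeConjecture.Theses.TropicalWeilObstruction
import Summits.HodgeConjecture.HodgeConjecture.Theorems.TropicalWeilObstructionTropicalHodgeBoundRationalHodgeCoordinates
import HarnessLib

/-!
# Route `TropicalWeilObstruction` (Kontsevich's tropical test, NEGATION SINK — exploration, no summit claim):
# what the closed crux K3 `TropicalHodgeBound` gives exactly, and the exact scope of the open crux K1
# `TropicalWeilVanishing`

HONEST STATUS. Nothing in this file bears on the Hodge conjecture. The route
`TropicalWeilObstruction` would refute HC only from K1 ∧ K2 ∧ K3 ∧ S; K3 (`TropicalHodgeBound`,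
stmt-HodgeConjecture-18480) and S (`GenericWeilPeriod`) are closed, K1 (`TropicalWeilVanishing`,
stmt-18478, Kontsevich's actual tropical question in `g = 8` — an OPEN PROBLEM) and K2
(`MumfordWeilShadow`, stmt-18479, the Mumford–Weil specialisation of effective cycles — XL, not in
print at value-group rank 16) are open. This file is bookkeeping for the negation sink
`pub-hodge-tropical`: it records, as kernel-checked statements, two readings that the prose of the
route leaves implicit.

1. **K3 sharpened** (`cyc_eq_ratCast_smul_thetaClass_of_weilFunctional_eq_zero`,
   `tropicalHodgeBound_pair`). The landed proof of K3 (p322554, `stub_rationalHodgeCoordinates`: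
   every tropical `(4,4)`-cycle class on a very general tropical Weil eightfold `ℝ⁸/Qℤ⁸` is
   `q₀ θ₄(Q) + q₁ Re w(Q) + q₂ Im w(Q)` with `qᵢ ∈ ℚ`) gives more than the filed "three `W = 0` cycles are
   dependent": a single effective tropical `4`-cycle with `W(Z) = 0` already has its class ON THE
   RATIONAL THETA LINE, `cyc Z = q • θ₄(Q)`, because `Ŵ(θ₄) = 0` and `Ŵ(Re w) = i Ŵ(Im w) ≠ 0`; hence any
   TWO such cycles have `ℚ`-dependent classes.
2. **K1's exact content** (`tropicalWeilVanishing_iff_thetaLine`). Given (1), the open crux K1 is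
   EQUIVALENT to: *on a very general principally polarised tropical Weil eightfold every effective
   tropical `4`-cycle has class a rational multiple of `θ₄(Q)`* — i.e. the two tropical Weil classes
   (and every class with a non-zero Weil component) are NOT effective. This is the failure of the
   tropical Hodge conjecture in the middle degree of the `16`-dimensional tropical Weil family for
   `K = ℚ(i)`, `g = 8` [cite: Zharkov2020TropicalWeil, pp. 1–2: "if the tropical Hodge fails for such an
   `X` then a generic member of the family … would provide a counterexample to the classical Hodge
   conjecture. The converse implication though may be false"; Zharkov works out `g = 4` only]. In
   `g = 4` the analogous statement is FALSE (effective tropical cycles with a Weil component exist,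
   consistent with the algebraicity of Weil classes on abelian fourfolds); `g = 8` is the first open
   case on both sides. Nothing here is evidence for K1.

References: [Zharkov2020TropicalWeil] I. Zharkov, arXiv:2002.02347, pp. 1–4;
[MikhalkinZharkov2014Eigenwave] G. Mikhalkin, I. Zharkov, LN UMI 15 (2014), Prop. 4.3, Thm. 5.4.
-/

set_option linter.dupNamespace false

noncomputable section

open scoped BigOperators
open Matrix
open Literature.AlgebraicGeometry.Tropical

namespace Summit.HodgeConjecture.HodgeConjecture.Theorems.TropicalHodgeBound

/-! ## §0 Display-only notation (the registered skeleton's local definitions, verbatim bodies) -/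

/-- The skeleton's `dzCoord n S`. -/
local notation3 (prettyPrint := false) "dz⟦" n "⟧" S:max =>
  (Matrix.det (Matrix.of fun k a : Fin n =>
    (if (S a : ℕ) = (k : ℕ) then (1 : ℂ) else 0) + (if (S a : ℕ) = (k : ℕ) + n then Complex.I else 0)))

/-- The skeleton's `weilPairing n C` (the value `Ŵ(C)`). -/
local notation3 (prettyPrint := false) "Ŵ⟦" n "⟧" C:max =>
  (∑ S : Fin n → Fin (2 * n), ∑ S' : Fin n → Fin (2 * n),
    dz⟦n⟧ S * dz⟦n⟧ S' / ((Nat.factorial n : ℂ) ^ 2) * ((C S S' : ℝ) : ℂ))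

/-- The skeleton's `thetaClass n Q`. -/
local notation3 (prettyPrint := false) "θ⟦" n "⟧" Q:max =>
  (fun S S' : Fin n → Fin (2 * n) => Matrix.det (Matrix.submatrix Q S S'))

/-- The skeleton's `omegaFrame n` (`Ω`, the frame `ω_b = e_b - i e_{b+n}`). -/
local notation3 (prettyPrint := false) "Ω⟦" n "⟧" =>
  (Matrix.of fun (a : Fin (2 * n)) (b : Fin n) =>
    (if (a : ℕ) = (b : ℕ) then (1 : ℂ) else 0) - (if (a : ℕ) = (b : ℕ) + n then Complex.I else 0))

/-- The skeleton's `weilClassC n Q` (`w(Q) = (⋀ⁿQ ⊗ 1)(Ω ⊗ Ω)`). -/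
local notation3 (prettyPrint := false) "wC⟦" n "⟧" Q:max =>
  (fun S S' : Fin n → Fin (2 * n) =>
    Matrix.det (Matrix.submatrix (Matrix.map Q ((↑) : ℝ → ℂ) * Ω⟦n⟧) S id) *
      Matrix.det (Matrix.submatrix (Ω⟦n⟧) S' id))

/-- The skeleton's `weilClassRe n Q` (`w₁ = Re w`). -/
local notation3 (prettyPrint := false) "wRe⟦" n "⟧" Q:max =>
  (fun S S' : Fin n → Fin (2 * n) => Complex.re ((wC⟦n⟧ Q) S S'))

/-- The skeleton's `weilClassIm n Q` (`w₂ = Im w`). -/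
local notation3 (prettyPrint := false) "wIm⟦" n "⟧" Q:max =>
  (fun S S' : Fin n → Fin (2 * n) => Complex.im ((wC⟦n⟧ Q) S S'))

/-! ## §1 `Ŵ` is homogeneous; the rung "theta multiples have `W = 0`" -/

/-- `Ŵ(r • C) = r · Ŵ(C)` for a real scalar (the pairing is linear). [folklore] -/
theorem weilPairing_smul (r : ℝ) (C : (Fin 4 → Fin (2 * 4)) → (Fin 4 → Fin (2 * 4)) → ℝ) :
    Ŵ⟦4⟧ (r • C) = (r : ℂ) * Ŵ⟦4⟧ C := by
  rw [Finset.mul_sum]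
  refine Finset.sum_congr rfl fun S _ => ?_
  rw [Finset.mul_sum]
  refine Finset.sum_congr rfl fun S' _ => ?_
  simp only [Pi.smul_apply, smul_eq_mul, Complex.ofReal_mul]
  ring

/-- `Ŵ(q • C) = q · Ŵ(C)` for a rational scalar. [folklore] -/
theorem weilPairing_ratCast_smul (q : ℚ) (C : (Fin 4 → Fin (2 * 4)) → (Fin 4 → Fin (2 * 4)) → ℝ) :
    Ŵ⟦4⟧ (((q : ℚ) : ℝ) • C) = (q : ℂ) * Ŵ⟦4⟧ C := by
  rw [weilPairing_smul, Complex.ofReal_ratCast]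

/-- **The rung of the crux's first line (`Cruxes/TropicalWeilVanishing/Lines/birth.lean`,
`stub_rung_thetaMultiples`, skeleton-local `thetaClass` unfolded; `PosDef` not needed):** at every Weil
period `Q` (`QJ = JQ`) an effective tropical `4`-cycle whose class is a REAL multiple of `θ₄(Q)` has
`W(Z) = 0`, since `W = Ŵ ∘ cyc` and `Ŵ(θ₄(Q)) = det (P Q Pᵀ) = 0`. [cite: Zharkov2020TropicalWeil, §2] -/
theorem weilFunctional_eq_zero_of_cyc_eq_smul_thetaClass (Q : Matrix (Fin (2 * 4)) (Fin (2 * 4)) ℝ)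
    (hJ : Q * weilJ 4 = weilJ 4 * Q) (Z : TropicalTorusCycle (2 * 4) 4 Q) (r : ℝ)
    (h : TropicalTorusCycle.cyc Z = r • θ⟦4⟧ Q) : weilFunctional Z = 0 := by
  rw [stub_weilFunctional_eq_pairing Q Z, h, weilPairing_smul,
    weilPairing_thetaClass_eq_zero (by norm_num) Q hJ, mul_zero]

/-- The registered signature of `stub_rung_thetaMultiples` (line `birth` of K1), with the skeleton's
`thetaClass Q` unfolded to its body. [cite: Zharkov2020TropicalWeil, §2] -/
theorem tropicalWeilVanishing_rung_thetaMultiples :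
    ∀ Q : Matrix (Fin (2 * 4)) (Fin (2 * 4)) ℝ, Q.PosDef → Q * weilJ 4 = weilJ 4 * Q →
      ∀ Z : TropicalTorusCycle (2 * 4) 4 Q, (∃ r : ℝ, Z.cyc = r • θ⟦4⟧ Q) → weilFunctional Z = 0 :=
  fun Q _ hJ Z ⟨r, h⟩ => weilFunctional_eq_zero_of_cyc_eq_smul_thetaClass Q hJ Z r h

/-! ## §2 K3 sharpened: `W(Z) = 0` puts the class on the rational theta line -/

/-- **K3 sharpened.** On a very general principally polarised tropical Weil eightfold `ℝ⁸/Qℤ⁸`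
(`Q ≻ 0`, `QJ = JQ`, `IsWeilGeneric 4 Q`), an effective tropical `4`-cycle with vanishing Weil
functional has class a RATIONAL multiple of the theta class: `cyc Z = q • θ₄(Q)`. (From the landed
stub 4 `stub_rationalHodgeCoordinates` and stubs 1–3: `W = Ŵ ∘ cyc`, `Ŵ(θ₄) = 0`,
`Ŵ(Re w), Ŵ(Im w)` `ℚ`-independent.) [cite: Zharkov2020TropicalWeil, §2]
[cite: MikhalkinZharkov2014Eigenwave, Prop. 4.3 and Thm. 5.4] -/
theorem cyc_eq_ratCast_smul_thetaClass_of_weilFunctional_eq_zero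
    (Q : Matrix (Fin (2 * 4)) (Fin (2 * 4)) ℝ) (hQ : Q.PosDef) (hJ : Q * weilJ 4 = weilJ 4 * Q)
    (hgen : IsWeilGeneric 4 Q) (Z : TropicalTorusCycle (2 * 4) 4 Q) (hW : weilFunctional Z = 0) :
    ∃ q : ℚ, TropicalTorusCycle.cyc Z = ((q : ℚ) : ℝ) • θ⟦4⟧ Q := by
  obtain ⟨q, hq⟩ := stub_rationalHodgeCoordinates Q hQ hJ hgen Z
  have h0 : Ŵ⟦4⟧ (TropicalTorusCycle.cyc Z) = 0 := by
    rw [← stub_weilFunctional_eq_pairing Q Z]; exact hW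
  have hθ : Ŵ⟦4⟧ (θ⟦4⟧ Q) = 0 := weilPairing_thetaClass_eq_zero (by norm_num) Q hJ
  rw [hq] at h0
  simp only [Pi.add_apply, Pi.smul_apply, smul_eq_mul, Complex.ofReal_add, Complex.ofReal_mul,
    Complex.ofReal_ratCast, mul_add, Finset.sum_add_distrib] at h0
  have e1 : ∀ (r : ℚ) (C : (Fin 4 → Fin (2 * 4)) → (Fin 4 → Fin (2 * 4)) → ℝ),
      ∑ S : Fin 4 → Fin (2 * 4), ∑ S' : Fin 4 → Fin (2 * 4),
        dz⟦4⟧ S * dz⟦4⟧ S' / ((Nat.factorial 4 : ℂ) ^ 2) * ((r : ℂ) * ((C S S' : ℝ) : ℂ)) =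
      (r : ℂ) * Ŵ⟦4⟧ C := by
    intro r C
    rw [Finset.mul_sum]
    refine Finset.sum_congr rfl fun S _ => ?_
    rw [Finset.mul_sum]
    refine Finset.sum_congr rfl fun S' _ => ?_
    ring
  rw [e1, e1, e1, hθ, mul_zero, zero_add] at h0
  obtain ⟨h1, h2⟩ := stub_weilPairing_weilClasses Q hQ hJ (q 1) (q 2) h0
  refine ⟨q 0, ?_⟩
  rw [hq, h1, h2]
  simp

/-- **K3 for pairs.** Under the hypotheses of `TropicalHodgeBound`, already TWO effective tropical
`4`-cycles with vanishing Weil functional have `ℚ`-linearly dependent classes (both lie on the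
rational theta line). The filed crux quantifies over three cycles because the route's assembly needs
three; the mathematics gives two. [cite: Zharkov2020TropicalWeil, §2] -/
theorem tropicalHodgeBound_pair (Q : Matrix (Fin (2 * 4)) (Fin (2 * 4)) ℝ) (hQ : Q.PosDef)
    (hJ : Q * weilJ 4 = weilJ 4 * Q) (hgen : IsWeilGeneric 4 Q)
    (c : Fin 2 → TropicalTorusCycle (2 * 4) 4 Q) (hW : ∀ j, weilFunctional (c j) = 0) :
    ¬ LinearIndependent ℚ fun j => (c j).cyc := by
  choose q hq using fun j =>
    cyc_eq_ratCast_smul_thetaClass_of_weilFunctional_eq_zero Q hQ hJ hgen (c j) (hW j)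
  rw [Fintype.not_linearIndependent_iff]
  by_cases h0 : q 0 = 0
  · refine ⟨![1, 0], ?_, ⟨0, by simp⟩⟩
    simp only [Fin.sum_univ_two]
    rw [hq 0, h0]
    simp
  · refine ⟨![q 1, -(q 0)], ?_, ⟨1, by simpa using h0⟩⟩
    simp only [Fin.sum_univ_two]
    rw [hq 0, hq 1]
    funext S S'
    simp only [Matrix.cons_val_zero, Matrix.cons_val_one, Pi.add_apply, Pi.smul_apply,
      Pi.zero_apply, smul_eq_mul, Rat.smul_def]
    push_cast
    ring

/-! ## §3 The exact scope of K1 -/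

/-- **K1 ⟺ "every effective tropical `4`-cycle class is on the rational theta line".** Given the
landed K3 ingredients, the OPEN crux `TropicalWeilVanishing` (stmt-HodgeConjecture-18478) is
equivalent to: for every very general principally polarised tropical Weil eightfold `ℝ⁸/Qℤ⁸` and every
effective tropical `4`-cycle `Z` on it, `cyc Z ∈ ℚ · θ₄(Q)` — the tropical Weil classes `Re w(Q)`,
`Im w(Q)` (and every class with a non-zero Weil component) are not classes of effective tropical
cycles, i.e. the tropical Hodge conjecture FAILS in bidegree `(4,4)` on the very general tropical Weil
eightfold. A restatement of an open problem, not progress on it. [cite: Zharkov2020TropicalWeil, pp. 1–2] -/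
theorem tropicalWeilVanishing_iff_thetaLine :
    Summit.HodgeConjecture.HodgeConjecture.Theses.TropicalWeilObstruction.TropicalWeilVanishing ↔
      ∀ Q : Matrix (Fin (2 * 4)) (Fin (2 * 4)) ℝ, Q.PosDef → Q * weilJ 4 = weilJ 4 * Q →
        IsWeilGeneric 4 Q → ∀ Z : TropicalTorusCycle (2 * 4) 4 Q,
          ∃ q : ℚ, TropicalTorusCycle.cyc Z = ((q : ℚ) : ℝ) • θ⟦4⟧ Q := by
  constructor
  · intro h Q hQ hJ hgen Z
    exact cyc_eq_ratCast_smul_thetaClass_of_weilFunctional_eq_zero Q hQ hJ hgen Z (h Q hQ hJ hgen Z)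
  · intro h Q hQ hJ hgen Z
    obtain ⟨q, hq⟩ := h Q hQ hJ hgen Z
    exact weilFunctional_eq_zero_of_cyc_eq_smul_thetaClass Q hJ Z _ hq

/-- **K1 ⟺ "every effective tropical `4`-cycle class is a REAL theta multiple"** (the dichotomy of
line `birth`: at a very general Weil period there is no effective tropical `4`-cycle with non-theta
class). Real and rational theta multiples coincide for cycle classes by K3's rationality.
[cite: Zharkov2020TropicalWeil, pp. 1–2] -/
theorem tropicalWeilVanishing_iff_real_thetaLine :
    Summit.HodgeConjecture.HodgeConjecture.Theses.TropicalWeilObstruction.TropicalWeilVanishing ↔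
      ∀ Q : Matrix (Fin (2 * 4)) (Fin (2 * 4)) ℝ, Q.PosDef → Q * weilJ 4 = weilJ 4 * Q →
        IsWeilGeneric 4 Q → ∀ Z : TropicalTorusCycle (2 * 4) 4 Q,
          ∃ r : ℝ, TropicalTorusCycle.cyc Z = r • θ⟦4⟧ Q := by
  rw [tropicalWeilVanishing_iff_thetaLine]
  constructor
  · intro h Q hQ hJ hgen Z
    obtain ⟨q, hq⟩ := h Q hQ hJ hgen Z
    exact ⟨((q : ℚ) : ℝ), hq⟩
  · intro h Q hQ hJ hgen Z
    obtain ⟨r, hr⟩ := h Q hQ hJ hgen Z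
    exact cyc_eq_ratCast_smul_thetaClass_of_weilFunctional_eq_zero Q hQ hJ hgen Z
      (weilFunctional_eq_zero_of_cyc_eq_smul_thetaClass Q hJ Z r hr)

end Summit.HodgeConjecture.HodgeConjecture.Theorems.TropicalHodgeBound

end
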